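import Summits.CriticalPhenomena.PercolationContinuityZ3.Theorems.PercNearOneGluingNoHeavyLowerTailSunflowerChainCertificateEnumeration
import HarnessLib
import HarnessLib.Audit

/-!
# `NoHeavyLowerTail` (crux stmt-CriticalPhenomena-4575), chain certificates — FINITE VERIFICATION II: the checker (`X_loc`, its fast form,
# block-symmetry filter, `checkPatternFrom/checkPattern/checkAll`) and admissibility of the cell list of a valid datum

Support file (seat `prim-ineq-prove-1` gen 33; `--supports stmt-CriticalPhenomena-4575`); part of the kernel replay of
`ChainCert.ThreeBlockMedianCertificate` (files …ChainCertificate ⟵ …Structure ⟵ …Duality ⟵ …Local ⟵ …Enumeration ⟵ …Checker ⟵ …Reps ⟵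
…Sound ⟵ …Final ⟵ compiled-check files ⟵ …Holds).  No `sorry`, no named facts, nothing asserted about the crux.  The whole chain elaborates as
ONE file (HOME/code-g33/lean/File6dev.lean, rc 0); these tree files are consecutive verbatim slices of it.  Memo:
run/shared/lean/prim/prim-ineq-prove-1/FINDING-CHAINCERT-prove1-g33.md §4–§7.

CONTENTS.  `preCand` (= validity `M_Z, M_O, M_lt, M_lift1, M_lift2`), `repCand` (`M_lift1_ne`), `candP`; `threeReps`, `petOf`, `forcedP` (canonical
(median, maximum) positions of local rainbows with bottom median = `M_loc`), `isForced`; reference bound `Xloc = Σ_slots (aTermP + lbTermP)` and fast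
form `XlocFast` with one-pass `classify`/`classify_eq`; `bgen` (the all-strict pattern), `permuteCells/cellKey/isCanon` (for `bgen` only the cell lists
minimal in their block-`S₃` orbit are examined); `checkPatternFrom b pre` (depth-first from a cell prefix — chunkable), `checkPattern`, `allPatterns`,
`checkAll`.  Then `patPre` preorder / `eqvJ` equivalence lemmas, cell codes (`cellOf_*`, `cellOf_mono`), `cellsList`, `leT_leTab`, `cmpTabs_getD` use, and
**`cellsList_choices`** (every entry of the cell list of a VALID datum is an admissible choice given its prefix).
-/

namespace Summit.CriticalPhenomena.PercolationContinuityZ3.Theorems.SunflowerPartition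

namespace ChainCert

open Finset

section FiniteCheck

variable {n : Fin 3 → ℕ}

/-! #### The bound `X_loc` -/

/-- Strict increase of a pair in every block, under a pattern. [this work] -/
def strictJ (b : Fin 3 → Bool × Bool) (x y : J) : Bool :=
  (patPre b 0 (x 0) (y 0) && !patPre b 0 (y 0) (x 0)) && (patPre b 1 (x 1) (y 1) && !patPre b 1 (y 1) (x 1)) &&
    (patPre b 2 (x 2) (y 2) && !patPre b 2 (y 2) (x 2))

/-- The label-independent candidate conditions for a transfer pair (constraints `M_Z`, `M_O`, `M_lt`, `M_lift1`, `M_lift2`). [this work] -/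
def preCand (b : Fin 3 → Bool × Bool) (ca : Array (Fin 3)) (s : SlotRec) : Bool :=
  decide (ca.getD s.px 1 = 0) && decide (ca.getD s.py 1 = 2) &&
  ((patPre b 0 s.xs0 s.ys0 && !patPre b 0 s.ys0 s.xs0) && (patPre b 1 s.xs1 s.ys1 && !patPre b 1 s.ys1 s.xs1) &&
    (patPre b 2 s.xs2 s.ys2 && !patPre b 2 s.ys2 s.xs2)) &&
  (decide (ca.getD s.pu0 1 ≠ 0) && decide (ca.getD s.pu1 1 ≠ 0) && decide (ca.getD s.pu2 1 ≠ 0)) &&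
  (decide (ca.getD s.pv0 1 = 2) && decide (ca.getD s.pv1 1 = 2) && decide (ca.getD s.pv2 1 = 2))

/-- The label-dependent candidate condition (`M_lift1_ne`): petal one-block lifts carry distinct representatives. [this work] -/
def repCand (ca : Array (Fin 3)) (ra : Array ℕ) (s : SlotRec) : Bool :=
  decide (ca.getD s.pu0 1 = 1 → ca.getD s.pu1 1 = 1 → ra.getD s.pu0 0 ≠ ra.getD s.pu1 0) &&
    decide (ca.getD s.pu0 1 = 1 → ca.getD s.pu2 1 = 1 → ra.getD s.pu0 0 ≠ ra.getD s.pu2 0) &&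
    decide (ca.getD s.pu1 1 = 1 → ca.getD s.pu2 1 = 1 → ra.getD s.pu1 0 ≠ ra.getD s.pu2 0)

/-- The candidate conditions for a transfer pair, from the cell and representative arrays. [this work] -/
def candP (b : Fin 3 → Bool × Bool) (ca : Array (Fin 3)) (ra : Array ℕ) (s : SlotRec) : Bool :=
  preCand b ca s && repCand ca ra s

/-- Do the petal positions carry at least three distinct representatives? [this work] -/
def threeReps (ra : Array ℕ) (pet : List ℕ) : Bool :=
  match pet.find? (fun _ => true) with
  | none => false
  | some k₁ =>
    match pet.find? (fun k => ra.getD k 0 ≠ ra.getD k₁ 0) with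
    | none => false
    | some k₂ => pet.any fun k => ra.getD k 0 ≠ ra.getD k₁ 0 ∧ ra.getD k 0 ≠ ra.getD k₂ 0

/-- The petal positions of a cell array. [this work] -/
def petOf (ca : Array (Fin 3)) : List ℕ := (List.range 27).filter fun k => ca.getD k 1 = 1

/-- The forced transfer pairs (canonical positions of median and maximum) of the local rainbows with a bottom median, given the list
`pet` of petal positions. [this work] -/
def forcedP (mt : Array (ℕ × ℕ)) (ca : Array (Fin 3)) (ra : Array ℕ) (pet : List ℕ) : List (ℕ × ℕ) :=
  if !threeReps ra pet then [] else
  pet.flatMap fun k₁ => pet.flatMap fun k₂ =>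
    if k₁ < k₂ ∧ ra.getD k₁ 0 ≠ ra.getD k₂ 0 then
      pet.flatMap fun k₃ =>
        if k₂ < k₃ ∧ ra.getD k₁ 0 ≠ ra.getD k₃ 0 ∧ ra.getD k₂ 0 ≠ ra.getD k₃ 0 ∧
            ca.getD (mt.getD ((k₁ * 27 + k₂) * 27 + k₃) (0, 0)).1 1 = 0 then
          [mt.getD ((k₁ * 27 + k₂) * 27 + k₃) (0, 0)] else []
    else []

/-- Is the slot pair `(x,y)` a forced pair (via canonical positions)? [this work] -/
def isForced (ct : Array ℕ) (F : List (ℕ × ℕ)) (s : SlotRec) : Bool :=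
  F.any fun p => p.1 == ct.getD s.px 0 && p.2 == ct.getD s.py 0

/-- The `M`-independent part of the abstract kernel, from the arrays. [this work] -/
def aTermP (ca : Array (Fin 3)) (ra : Array ℕ) (s : SlotRec) : ℤ :=
  6 * (if ca.getD s.px 1 = 2 ∧ ca.getD s.py 1 = 2 ∧ ca.getD s.pz 1 = 0 then 1 else 0)
    - 3 * (if ca.getD s.px 1 = 2 ∧ ca.getD s.py 1 = 1 ∧ ca.getD s.pz 1 = 1 ∧ ra.getD s.py 0 ≠ ra.getD s.pz 0 then 1 else 0)
    - (if ca.getD s.px 1 = 1 ∧ ca.getD s.py 1 = 1 ∧ ca.getD s.pz 1 = 1 ∧ ra.getD s.px 0 ≠ ra.getD s.py 0 ∧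
          ra.getD s.px 0 ≠ ra.getD s.pz 0 ∧ ra.getD s.py 0 ≠ ra.getD s.pz 0 then 1 else 0)

/-- Inner lower bound for a label-independent candidate slot: exact for forced pairs, pessimistic otherwise. [this work] -/
def lbInner (ct : Array ℕ) (ca : Array (Fin 3)) (ra : Array ℕ) (F : List (ℕ × ℕ)) (s : SlotRec) : ℤ :=
  if isForced ct F s then -6 * ((if ca.getD s.pz 1 = 2 then 1 else 0) - (if ca.getD s.pz 1 = 0 then 1 else 0))
  else if repCand ca ra s then -6 * (if ca.getD s.pz 1 = 2 then 1 else 0) else 0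

/-- The termwise lower bound for the transfer part of the abstract kernel, from the arrays. [this work] -/
def lbTermP (b : Fin 3 → Bool × Bool) (ct : Array ℕ) (ca : Array (Fin 3)) (ra : Array ℕ) (F : List (ℕ × ℕ)) (s : SlotRec) : ℤ :=
  if preCand b ca s then lbInner ct ca ra F s else 0

/-- The LOWER BOUND `X_loc` of the abstract orbit sum over all valid transfer relations (reference form). [this work] -/
def Xloc (b : Fin 3 → Bool × Bool) (ct : Array ℕ) (mt : Array (ℕ × ℕ)) (ca : Array (Fin 3)) (ra : Array ℕ) : ℤ :=
  let F := forcedP mt ca ra (petOf ca)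
  (slotRecs.map fun s => aTermP ca ra s + lbTermP b ct ca ra F s).sum

/-- Label-independent slot filters of a cell array (computed once per cell configuration). [this work] -/
def pre220 (ca : Array (Fin 3)) (s : SlotRec) : Bool := decide (ca.getD s.px 1 = 2 ∧ ca.getD s.py 1 = 2 ∧ ca.getD s.pz 1 = 0)
/-- Label-independent slot filters of a cell array. [this work] -/
def pre211 (ca : Array (Fin 3)) (s : SlotRec) : Bool := decide (ca.getD s.px 1 = 2 ∧ ca.getD s.py 1 = 1 ∧ ca.getD s.pz 1 = 1)
/-- Label-independent slot filters of a cell array. [this work] -/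
def pre111 (ca : Array (Fin 3)) (s : SlotRec) : Bool := decide (ca.getD s.px 1 = 1 ∧ ca.getD s.py 1 = 1 ∧ ca.getD s.pz 1 = 1)
/-- Label-dependent parts of the petal terms. [this work] -/
def rep211 (ra : Array ℕ) (s : SlotRec) : Bool := decide (ra.getD s.py 0 ≠ ra.getD s.pz 0)
/-- Label-dependent parts of the petal terms. [this work] -/
def rep111 (ra : Array ℕ) (s : SlotRec) : Bool :=
  decide (ra.getD s.px 0 ≠ ra.getD s.py 0 ∧ ra.getD s.px 0 ≠ ra.getD s.pz 0 ∧ ra.getD s.py 0 ≠ ra.getD s.pz 0)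

/-- FAST form of `X_loc`: the label-independent filtering is done once per cell configuration (`L₀ L₂ L₃ Lc`). [this work] -/
def XlocFast (ct : Array ℕ) (mt : Array (ℕ × ℕ)) (ca : Array (Fin 3)) (pet : List ℕ) (n₁ : ℤ) (L₂ L₃ Lc : List SlotRec)
    (ra : Array ℕ) : ℤ :=
  let F := forcedP mt ca ra pet
  6 * n₁ - 3 * ((L₂.filter (rep211 ra)).length : ℤ) - ((L₃.filter (rep111 ra)).length : ℤ) + (Lc.map (lbInner ct ca ra F)).sum

/-- One-pass classification of the slot records by the cells: the count of `(2,2,0)` slots and the lists of `(2,1,1)`, `(1,1,1)` and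
label-independent candidate slots. [this work] -/
def classify (b : Fin 3 → Bool × Bool) (ca : Array (Fin 3)) : List SlotRec → ℤ × List SlotRec × List SlotRec × List SlotRec
  | [] => (0, [], [], [])
  | s :: l =>
    let r := classify b ca l
    let cx := ca.getD s.px 1
    if cx = 2 then
      let cy := ca.getD s.py 1
      if cy = 2 then (if ca.getD s.pz 1 = 0 then (r.1 + 1, r.2.1, r.2.2.1, r.2.2.2) else r)
      else if cy = 1 then (if ca.getD s.pz 1 = 1 then (r.1, s :: r.2.1, r.2.2.1, r.2.2.2) else r)
      else r
    else if cx = 1 then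
      (if ca.getD s.py 1 = 1 ∧ ca.getD s.pz 1 = 1 then (r.1, r.2.1, s :: r.2.2.1, r.2.2.2) else r)
    else (if preCand b ca s then (r.1, r.2.1, r.2.2.1, s :: r.2.2.2) else r)

/-- `classify` computes the four filters. [this work] -/
theorem classify_eq (b : Fin 3 → Bool × Bool) (ca : Array (Fin 3)) (l : List SlotRec) :
    classify b ca l = (((l.filter (pre220 ca)).length : ℤ), l.filter (pre211 ca), l.filter (pre111 ca), l.filter (preCand b ca)) := by
  induction l with
  | nil => rfl
  | cons s l ih =>
    simp only [classify, ih, List.filter_cons]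
    have h3 : ∀ v : Fin 3, v = 0 ∨ v = 1 ∨ v = 2 := by decide
    have hpc : ca.getD s.px 1 ≠ 0 → preCand b ca s = false := by
      intro h
      have hd : decide (ca.getD s.px 1 = 0) = false := decide_eq_false h
      simp only [preCand, hd, Bool.false_and]
    rcases h3 (ca.getD s.px 1) with hx | hx | hx <;> rcases h3 (ca.getD s.py 1) with hy | hy | hy <;>
      rcases h3 (ca.getD s.pz 1) with hz | hz | hz <;>
      simp [pre220, pre211, pre111, hx, hy, hz, hpc] <;> split <;> simp_all

/-- The generic (all-strict) comparison pattern — the bulk of the computation; it is symmetric under permutations of the three blocks,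
which the checker exploits (`isCanon`) and which is verified in chunks by cell prefixes. [this work] -/
def bgen : Fin 3 → Bool × Bool := ![(false, false), (false, false), (false, false)]

/-- The cell list after permuting the blocks by `π` (position `k` reads the cell of the index vector `decN k ∘ π`). [this work] -/
def permuteCells (π : Equiv.Perm (Fin 3)) (c : List (Fin 3)) : List (Fin 3) :=
  List.ofFn (n := 27) fun k => c.getD (encN ((decN k.val) ∘ π)) 1

/-- A numeric key of a cell list (base-3 reading), used to pick one representative per block-symmetry orbit. [this work] -/
def cellKey (c : List (Fin 3)) : ℕ := c.foldl (fun acc v => 3 * acc + v.val) 0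

/-- Block-symmetry filter: for the generic pattern only the cell lists whose key is minimal in their `S₃`-orbit are examined. [this work] -/
def isCanon (b : Fin 3 → Bool × Bool) (c : List (Fin 3)) : Bool :=
  if b = bgen then permList.all fun π => decide (cellKey c ≤ cellKey (permuteCells π c)) else true

/-- The check for one comparison pattern FROM A CELL PREFIX: every admissible (cells, representatives) configuration extending `pre`
— for the generic pattern only the block-symmetry representatives (`isCanon`) — has `X_loc ≥ 0` (depth first; prefixes allow chunking
the computation). [this work] -/
def checkPatternFrom (b : Fin 3 → Bool × Bool) (pre : List (Fin 3)) : Bool :=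
  let lt := leTab b
  let ct := canonTab b
  let mt := medTab b ct
  let sr := slotRecs
  let ba := cmpTabs lt
  allSeq (choicesCell ba) (fun c =>
    if isCanon b c then
      let ca := c.toArray
      let cl := classify b ca sr
      let cp := compPet lt ca
      let pet := petOf ca
      allSeq (choicesRep cp ca) (fun r => decide (0 ≤ XlocFast ct mt ca pet cl.1 cl.2.1 cl.2.2.1 cl.2.2.2 r.toArray))
        27 []
    else true) (27 - pre.length) pre

/-- The check for one comparison pattern. [this work] -/
def checkPattern (b : Fin 3 → Bool × Bool) : Bool := checkPatternFrom b []

/-- All 64 comparison patterns. [this work] -/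
def allPatterns : List (Fin 3 → Bool × Bool) :=
  let bs := [(false, false), (false, true), (true, false), (true, true)]
  bs.flatMap fun b0 => bs.flatMap fun b1 => bs.map fun b2 => ![b0, b1, b2]

/-- The complete check. [this work] -/
def checkAll : Bool := allPatterns.all checkPattern


/-! ### E. Correctness of the enumeration: every valid local datum is covered -/

/-- `patPre` is reflexive. [this work] -/
theorem patPre_refl : ∀ (bb : Bool × Bool) (i : Fin 3), patPre (fun _ => bb) 0 i i = true := by decide

/-- `patPre` is transitive (checked on the four tie patterns). [this work] -/
theorem patPre_trans_aux : ∀ (bb : Bool × Bool) (i i' i'' : Fin 3),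
    patPre (fun _ => bb) 0 i i' = true → patPre (fun _ => bb) 0 i' i'' = true → patPre (fun _ => bb) 0 i i'' = true := by decide

/-- `patPre b e` only depends on `b e`. [this work] -/
theorem patPre_eq (b : Fin 3 → Bool × Bool) (e : Fin 3) (i i' : Fin 3) : patPre b e i i' = patPre (fun _ => b e) 0 i i' := rfl

/-- Transitivity of `patPre`. [this work] -/
theorem patPre_trans (b : Fin 3 → Bool × Bool) (e : Fin 3) {i i' i'' : Fin 3} (h1 : patPre b e i i' = true)
    (h2 : patPre b e i' i'' = true) : patPre b e i i'' = true := by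
  rw [patPre_eq] at *; exact patPre_trans_aux _ _ _ _ h1 h2

/-- `eqvJ` unfolded. [this work] -/
theorem eqvJ_eq_true_iff (b : Fin 3 → Bool × Bool) (j j' : J) :
    eqvJ b j j' = true ↔ ∀ e, patPre b e (j e) (j' e) = true ∧ patPre b e (j' e) (j e) = true := by
  simp only [eqvJ, Bool.and_eq_true, leJ_eq_true_iff]
  exact ⟨fun h e => ⟨h.1 e, h.2 e⟩, fun h => ⟨fun e => (h e).1, fun e => (h e).2⟩⟩

/-- `eqvJ` is reflexive. [this work] -/
theorem eqvJ_refl (b : Fin 3 → Bool × Bool) (j : J) : eqvJ b j j = true := by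
  rw [eqvJ_eq_true_iff]; intro e; rw [patPre_eq]; exact ⟨patPre_refl _ _, patPre_refl _ _⟩

/-- `eqvJ` is symmetric. [this work] -/
theorem eqvJ_symm (b : Fin 3 → Bool × Bool) {j j' : J} (h : eqvJ b j j' = true) : eqvJ b j' j = true := by
  rw [eqvJ_eq_true_iff] at *; exact fun e => ⟨(h e).2, (h e).1⟩

/-- `eqvJ` is transitive. [this work] -/
theorem eqvJ_trans (b : Fin 3 → Bool × Bool) {j j' j'' : J} (h1 : eqvJ b j j' = true) (h2 : eqvJ b j' j'' = true) :
    eqvJ b j j'' = true := by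
  rw [eqvJ_eq_true_iff] at *
  exact fun e => ⟨patPre_trans b e (h1 e).1 (h2 e).1, patPre_trans b e (h2 e).2 (h1 e).2⟩

/-- Cell code `0` means bottom. [this work] -/
theorem cellOf_eq_zero_iff (D : LocalDatum) (j : J) : D.cell j = 0 ↔ D.Z j = true := by
  unfold LocalDatum.cell; split_ifs with h1 h2 <;> simp [h1]

/-- Cell code `2` means kernel (for a valid datum). [this work] -/
theorem cellOf_eq_two_iff {pre : Fin 3 → Fin 3 → Fin 3 → Bool} {D : LocalDatum} (hv : D.Valid pre) (j : J) :
    D.cell j = 2 ↔ D.O j = true := by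
  unfold LocalDatum.cell; split_ifs with h1 h2
  · simp only [Fin.reduceEq, false_iff]; intro h; exact hv.Z_O j ⟨h1, h⟩
  · simp [h2]
  · simp [h2]

/-- Cell code `1` means petal. [this work] -/
theorem cellOf_eq_one_iff (D : LocalDatum) (j : J) : D.cell j = 1 ↔ (D.Z j = false ∧ D.O j = false) := by
  unfold LocalDatum.cell; split_ifs with h1 h2 <;> simp_all

/-- Monotonicity of cell codes along the comparison data (for a valid datum). [this work] -/
theorem cellOf_mono {pre : Fin 3 → Fin 3 → Fin 3 → Bool} {D : LocalDatum} (hv : D.Valid pre) {j j' : J}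
    (h : ∀ e, pre e (j e) (j' e) = true) : D.cell j ≤ D.cell j' := by
  rcases hv.mono j j' h with hE | hZ | hO
  · have hz := hv.E_Z j j' hE; have ho := hv.E_O j j' hE
    unfold LocalDatum.cell
    by_cases a : D.Z j = true
    · simp [a]
    · have a' : ¬ D.Z j' = true := fun h => a (hz.mpr h)
      by_cases c : D.O j = true
      · have c' : D.O j' = true := ho.mp c
        simp [a, a', c, c']
      · have c' : ¬ D.O j' = true := fun h => c (ho.mpr h)
        simp [a, a', c, c']
  · have : D.cell j = 0 := (cellOf_eq_zero_iff D j).mpr hZ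
    rw [this]; exact Fin.zero_le _
  · have : D.cell j' = 2 := (cellOf_eq_two_iff hv j').mpr hO
    rw [this]; exact Fin.le_last _ |>.trans (by decide)

/-- Points denoting the same point have the same cell code. [this work] -/
theorem cellOf_congr {pre : Fin 3 → Fin 3 → Fin 3 → Bool} {D : LocalDatum} (hv : D.Valid pre) {j j' : J}
    (h : ∀ e, pre e (j e) (j' e) = true ∧ pre e (j' e) (j e) = true) : D.cell j = D.cell j' :=
  le_antisymm (cellOf_mono hv fun e => (h e).1) (cellOf_mono hv fun e => (h e).2)

/-- The cell list of a datum (positions `0..26`). [this work] -/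
def cellsList (D : LocalDatum) : List (Fin 3) := List.ofFn (n := 27) fun k => D.cell (decN k.val)

/-- Entries of the cell list. [this work] -/
theorem cellsList_getD (D : LocalDatum) {k : ℕ} (hk : k < 27) : (cellsList D).getD k 1 = D.cell (decN k) := by
  rw [List.getD_eq_getElem?_getD, cellsList, List.getElem?_ofFn]
  simp [hk]

/-- Entries of a prefix of the cell list. [this work] -/
theorem cellsList_take_getD (D : LocalDatum) {k k' : ℕ} (hk' : k' < k) (hk : k ≤ 27) :
    ((cellsList D).take k).getD k' 1 = D.cell (decN k') := by
  rw [List.getD_eq_getElem?_getD, List.getElem?_take, if_pos hk', ← List.getD_eq_getElem?_getD]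
  exact cellsList_getD D (by omega)

/-- Entries of the cell array. [this work] -/
theorem cellsArray_getD (D : LocalDatum) (j : J) : (cellsList D).toArray.getD (encN j) 1 = D.cell j := by
  have h := cellsList_getD D (encN_lt j)
  rw [decN_encN] at h
  rw [← h, Array.getD_eq_getD_getElem?, List.getD_eq_getElem?_getD, List.getElem?_toArray]

/-- The comparability table agrees with `leJ`. [this work] -/
theorem leT_leTab (b : Fin 3 → Bool × Bool) {k' k : ℕ} (hk' : k' < 27) (hk : k < 27) :
    leT (leTab b) k' k = leJ b (decN k') (decN k) := by
  have hi : k' * 27 + k < 729 := by omega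
  rw [leT, leTab, Array.getD_eq_getD_getElem?, Array.getElem?_ofFn]
  simp only [hi, ↓reduceDIte, Option.getD_some]
  have h1 : (k' * 27 + k) / 27 = k' := by omega
  have h2 : (k' * 27 + k) % 27 = k := by omega
  rw [h1, h2]

/-- **Admissibility, cells**: every entry of the cell list of a valid datum is an admissible choice given its prefix. [this work] -/
theorem cellsList_choices {b : Fin 3 → Bool × Bool} {D : LocalDatum} (hv : D.Valid (patPre b)) (k : ℕ) (hk : k < (cellsList D).length) :
    (cellsList D)[k] ∈ choicesCell (cmpTabs (leTab b)) ((cellsList D).take k) := by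
  have hk27 : k < 27 := by simpa [cellsList] using hk
  have hlen : (List.take k (cellsList D)).length = k := by simp [cellsList]; omega
  have hget : (cellsList D)[k] = D.cell (decN k) := by simp only [cellsList, List.getElem_ofFn]
  simp only [choicesCell, List.size_toArray, list_toArray_getD, hlen, (cmpTabs_getD (leTab b) hk27).1, (cmpTabs_getD (leTab b) hk27).2,
    List.mem_filter, List.all_eq_true, List.mem_range, Bool.and_eq_true, decide_eq_true_eq]
  refine ⟨?_, fun k' hk' => ?_, fun k' hk' => ?_⟩
  · generalize (cellsList D)[k] = v; revert v; decide
  · have hk'27 : k' < 27 := by omega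
    rw [cellsList_take_getD D hk'.1 (le_of_lt hk27)]
    rw [leT_leTab b hk'27 hk27] at hk'
    exact (cellOf_mono hv ((leJ_eq_true_iff b _ _).mp hk'.2)).trans_eq hget.symm
  · have hk'27 : k' < 27 := by omega
    rw [cellsList_take_getD D hk'.1 (le_of_lt hk27)]
    rw [leT_leTab b hk27 hk'27] at hk'
    exact hget.trans_le (cellOf_mono hv ((leJ_eq_true_iff b _ _).mp hk'.2))



end FiniteCheck

end ChainCert

end Summit.CriticalPhenomena.PercolationContinuityZ3.Theorems.SunflowerPartition
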